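import Mathlib
import HarnessLib
import Summits.HubbardSuperconductivity.HubbardSuperconductivity.Theorems.KLProgrammeKLRegimeEngineWtBudget

/-!
# KL programme — K3 ENGINE child (`KLRegimeEngineV17F2`, stmt-HubbardSuperconductivity-20437), v2 interface TOKEN #19: the flow-telescoped
# (c-D) ALLOWANCE `klWtAllow` and the allowed weighted budget `klWtBudgetF = klWtBudget · klWtAllow` (option (B) shape, exponent 1)

Cell `gate-hubbard-kl`, seat hubbard-kl-k3c3-p2 (g9); pen (R59af)(i)/(R59ai)/(R59al): «file the Token19 Defs module now in option-(B) shape, identity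
recoverable; allowance EXPONENT 1» (E1 lead's word on question (10), KL STATUS 2026-08-27 19:55Z: the weighted (b) tower consumes the (c-D) SUM form
`base(j,m₀) + Σ_{m₀≤m<n} incr_m(j)` at REDUCED RATE and converts at the output by `klWtPinnedSum … (K_n) J ≤ (1 + X_J(n))·(identity-budget law)`,
`X_J(n) = θ_J·(n − m₀(J))₊`).  The DEFAULT of record is the identity allowance (#19 ≡ 1, (R59ai)); option (B) fires only on an explicit E1 word.

This module fixes the SHAPE only — the per-piece law `θ : ℕ → ℝ` is a PARAMETER (the (c-D) chain `…EngineSliceSpaceMoment.rowSumWt_flow_telescope_le`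
delivers an `m`-free per-piece amount whose ratio to the identity budget is the `θ` the engine lineage fixes when/if (B) fires; CD-LIMITS §1:
`θ_j ≍ c_R·|U|^{7/4}·2^{−3j/2}` in the registered `uPow 0 = |U|` currency, `≍ c_R·U²·2^{−3j/2}` in the `U²` currency of cure (K5)):

* `klCDBase U j = 2j + 5 + ⌈log₄ (U²)⁻¹⌉₊` — the harmless depth `m₀(j)` (E1-WORD10: the pieces `m < m₀(j)` stay inside the slice-`j` symbol, the pieces
  `m ≥ m₀(j)` are telescoped; `j*(n) = ⌈(n − 5 − log₄U⁻²)/2⌉` is the first level with `m₀(j) ≥ n`);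
* `klWtAllow θ U n j = 1 + θ j · (n − m₀(j))₊` — EXPONENT 1; `= 1` whenever `n ≤ m₀(j)` (in particular at the top level `j = n`);
* `klWtBudgetF P Q θ U n j m = klWtBudget P Q U j m · klWtAllow θ U n j` — the allowed budget (render token #19: `klWtBudget P Q U j ↦ klWtBudgetF P Q θ U n j`).

Bookkeeping rows: `klWtAllow_eq_one_of_le`, `klWtBudgetF_eq_of_le` (identity recoverable), `one_le_klWtAllow`, `klWtBudget_le_klWtBudgetF`,
`klWtAllow_mono` (monotone in `n`), `klWtAllow_le_of_le` (monotone in the law).  Definitions with bodies; nothing about the model is asserted.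
[cite: BenfattoGiulianiMastropietro2006, §3 (3.2)–(3.8)]
-/

noncomputable section

namespace Summit.HubbardSuperconductivity.HubbardSuperconductivity.Theorems.EngineV8

set_option linter.dupNamespace false -- summit = problem name (single-conjunct summit), D-0017

open Real
open Summit.HubbardSuperconductivity.HubbardSuperconductivity.Theorems.KLRegimeSplit

/-- **The (c-D) harmless depth** `m₀(j) = 2j + 5 + ⌈log₄ (U²)⁻¹⌉₊`: the flow pieces `m < m₀(j)` stay inside the slice-`j` symbol (derivative route,
`Λ_j²·Gfr₃U²4^{m₀} ≍ 1`), the pieces `m ≥ m₀(j)` are telescoped. -/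
def klCDBase (U : ℝ) (j : ℕ) : ℕ := 2 * j + 5 + ⌈Real.logb 4 (U ^ 2)⁻¹⌉₊

/-- **TOKEN #19 allowance, exponent 1**: `klWtAllow θ U n j = 1 + θ j · (n − m₀(j))₊` for a per-piece law `θ : ℕ → ℝ` (one `m`-free increment per
telescoped piece, CD-LIMITS §1 / `…EngineSliceSpaceMoment`). -/
def klWtAllow (θ : ℕ → ℝ) (U : ℝ) (n j : ℕ) : ℝ := 1 + θ j * max ((n : ℝ) - (klCDBase U j : ℝ)) 0

/-- **TOKEN #19 allowed budget**: `klWtBudgetF P Q θ U n j m = klWtBudget P Q U j m · klWtAllow θ U n j`. -/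
def klWtBudgetF (P : SplitConsts) (Q : EngConsts) (θ : ℕ → ℝ) (U : ℝ) (n j : ℕ) : ℕ → ℝ :=
  fun m => klWtBudget P Q U j m * klWtAllow θ U n j

/-- Unfolding `klWtAllow`. -/
theorem klWtAllow_def (θ : ℕ → ℝ) (U : ℝ) (n j : ℕ) : klWtAllow θ U n j = 1 + θ j * max ((n : ℝ) - (klCDBase U j : ℝ)) 0 := rfl

/-- Unfolding `klWtBudgetF`. -/
theorem klWtBudgetF_apply (P : SplitConsts) (Q : EngConsts) (θ : ℕ → ℝ) (U : ℝ) (n j m : ℕ) :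
    klWtBudgetF P Q θ U n j m = klWtBudget P Q U j m * klWtAllow θ U n j := rfl

/-- **Identity recoverable**: `klWtAllow θ U n j = 1` whenever `n ≤ m₀(j)` (no telescoped piece; in particular at the top level `j = n`). -/
theorem klWtAllow_eq_one_of_le (θ : ℕ → ℝ) {U : ℝ} {n j : ℕ} (h : n ≤ klCDBase U j) : klWtAllow θ U n j = 1 := by
  have h' : (n : ℝ) - (klCDBase U j : ℝ) ≤ 0 := by
    have : (n : ℝ) ≤ (klCDBase U j : ℝ) := by exact_mod_cast h
    linarith
  rw [klWtAllow, max_eq_right h', mul_zero, add_zero]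

/-- `klWtBudgetF = klWtBudget` whenever `n ≤ m₀(j)`. -/
theorem klWtBudgetF_eq_of_le (P : SplitConsts) (Q : EngConsts) (θ : ℕ → ℝ) {U : ℝ} {n j : ℕ} (h : n ≤ klCDBase U j) :
    klWtBudgetF P Q θ U n j = klWtBudget P Q U j := by
  funext m
  rw [klWtBudgetF_apply, klWtAllow_eq_one_of_le θ h, mul_one]

/-- The top level: `n ≤ m₀(n)`, hence `klWtAllow θ U n n = 1`. -/
theorem le_klCDBase_self (U : ℝ) (n : ℕ) : n ≤ klCDBase U n := by
  unfold klCDBase; omega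

/-- `klWtAllow θ U n n = 1`. -/
theorem klWtAllow_self (θ : ℕ → ℝ) (U : ℝ) (n : ℕ) : klWtAllow θ U n n = 1 :=
  klWtAllow_eq_one_of_le θ (le_klCDBase_self U n)

/-- `1 ≤ klWtAllow θ U n j` for a nonnegative law. -/
theorem one_le_klWtAllow {θ : ℕ → ℝ} (hθ : ∀ j, 0 ≤ θ j) (U : ℝ) (n j : ℕ) : 1 ≤ klWtAllow θ U n j := by
  rw [klWtAllow]
  have : 0 ≤ θ j * max ((n : ℝ) - (klCDBase U j : ℝ)) 0 := mul_nonneg (hθ j) (le_max_right _ _)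
  linarith

/-- `klWtBudget ≤ klWtBudgetF` (nonnegative law, `0 ≤ CE`, `0 ≤ Klam`): the allowed budget DOMINATES the identity budget, so every supply of the
identity-budget line is a supply of the allowed line. -/
theorem klWtBudget_le_klWtBudgetF {P : SplitConsts} {Q : EngConsts} {θ : ℕ → ℝ} (hθ : ∀ j, 0 ≤ θ j) (hCE : 0 ≤ Q.CE) (hK : 0 ≤ P.Klam)
    (U : ℝ) (n j m : ℕ) : klWtBudget P Q U j m ≤ klWtBudgetF P Q θ U n j m := by
  rw [klWtBudgetF_apply]
  exact le_mul_of_one_le_right (klWtBudget_nonneg hCE hK U j m) (one_le_klWtAllow hθ U n j)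

/-- Monotone in the scale `n` (nonnegative law). -/
theorem klWtAllow_mono {θ : ℕ → ℝ} (hθ : ∀ j, 0 ≤ θ j) (U : ℝ) (j : ℕ) {n n' : ℕ} (h : n ≤ n') :
    klWtAllow θ U n j ≤ klWtAllow θ U n' j := by
  rw [klWtAllow, klWtAllow]
  have : max ((n : ℝ) - (klCDBase U j : ℝ)) 0 ≤ max ((n' : ℝ) - (klCDBase U j : ℝ)) 0 :=
    max_le_max (by gcongr) le_rfl
  nlinarith only [this, hθ j]

/-- Monotone in the law: `θ ≤ θ′` pointwise ⇒ `klWtAllow θ ≤ klWtAllow θ′` (any majorant of the (c-D) per-piece law is admissible). -/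
theorem klWtAllow_le_of_le {θ θ' : ℕ → ℝ} (h : ∀ j, θ j ≤ θ' j) (U : ℝ) (n j : ℕ) : klWtAllow θ U n j ≤ klWtAllow θ' U n j := by
  rw [klWtAllow, klWtAllow]
  have := mul_le_mul_of_nonneg_right (h j) (le_max_right ((n : ℝ) - (klCDBase U j : ℝ)) 0)
  linarith

/-- The allowance against its `n`-free majorant on the KL regime's scales: if `θ j · (n − m₀(j))₊ ≤ A j` then `klWtAllow θ U n j ≤ 1 + A j`
(E1-WORD10 (W3): with `n ≤ nScales β + 1 ≲ c/(U² ln 4)` the product `θ_j·n` is `n`-free). -/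
theorem klWtAllow_le_one_add {θ A : ℕ → ℝ} {U : ℝ} {n j : ℕ} (h : θ j * max ((n : ℝ) - (klCDBase U j : ℝ)) 0 ≤ A j) :
    klWtAllow θ U n j ≤ 1 + A j := by
  rw [klWtAllow]; linarith

end Summit.HubbardSuperconductivity.HubbardSuperconductivity.Theorems.EngineV8

end
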